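import Mathlib
import Literature.Analysis.FluidPDE.VorticityCalculus
import Literature.Analysis.FluidPDE.BiotSavartCurlPair
import Literature.Analysis.FluidPDE.TaoAveragedNondegeneracy
import Summits.NavierStokesRegularity.NavierStokesRegularity.Theorems.ThreadingFluxCentreJetDefs
import Summits.NavierStokesRegularity.NavierStokesRegularity.Theorems.ThreadingFluxCentreJetVorticityJet
import HarnessLib

/-!
# Crux `PoloidalLiouville` (stmt-NavierStokesRegularity-1222, wall W1), crux idea «steady-centre-sieve» (ns-idea-15 g5):
# the centre vorticity jet E1 on a BALL (localisation by a radial cut-off)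

Support file (Theorems-side; seat ns-wall-eng-7 g5, cell ns-wall-extremal, W1 adjunct; `--supports stmt-NavierStokesRegularity-1222
--as helper`).  The card's conjectures C1/C1*/C1″ and its lemma L1 are statements about flows on a BALL `B(x₀, ρ)` that are
unthreaded ON THE BALL, while the landed kernel law E1 `CentreJet.centreVorticityJet` (p678931) asks for a `C³` field unthreaded on all
of `ℝ³`.  This file supplies the local form:

* `CentreJet.centreVorticityJet_of_ball` — `V ∈ C³(B(x₀, ρ))` with `⟪x − x₀, curl V x⟫ = 0` on `B(x₀, ρ)` has `curl V (x₀) = 0`,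
  `∇(curl V)(x₀)` skew and `Δ(curl V)(x₀) = 0`.

Proof: a RADIAL cut-off `χ(x) = ψ(‖x − x₀‖²)` (`ψ` a bump on `ℝ`, `= 1` near `0`, supported in `[−(3ρ/4)², (3ρ/4)²]`) keeps
unthreadedness — `curl (χV) = χ curl V + ∇χ × V` with `∇χ = 2ψ′ · (x − x₀)`, and `⟪x − x₀, (x − x₀) × V⟫ = 0` — so `χV` is a
GLOBAL `C³` unthreaded field agreeing with `V` near `x₀`, to which E1 applies; `curl`, its derivative and its Laplacian at `x₀` only see
the germ (tree `FrequencyRigidity.Negative.curl_congr` is the same germ-locality of the curl; inlined here).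

HONEST LABEL: vector-calculus localisation of an S-lemma; conjectures and target of the card, `PoloidalLiouville` (1222) and NS regularity
OPEN and untouched; information-grade.  [cite: MajdaBertozziCUP2002, §1.1 (vector identities)]
-/

-- the summit and its single problem share the name (D-0017 nested layout)
set_option linter.dupNamespace false

noncomputable section

open Set Function Filter
open scoped RealInnerProductSpace Topology
open Literature.Analysis.FluidPDE

namespace Summit.NavierStokesRegularity.NavierStokesRegularity.Theorems.PoloidalLiouville.CentreJet

section RadialCutoff

variable {V : E3 → E3} {x₀ : E3} {ρ : ℝ}

/-- Germ locality of the Laplacian: functions agreeing near `x` have the same Laplacian at `x`. -/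
theorem laplacian_congr_of_eventuallyEq {F : Type*} [NormedAddCommGroup F] [NormedSpace ℝ F] {f g : E3 → F} {x : E3}
    (h : f =ᶠ[𝓝 x] g) : Laplacian.laplacian f x = Laplacian.laplacian g x := by
  rw [congrFun (InnerProductSpace.laplacian_eq_iteratedFDeriv_orthonormalBasis f (EuclideanSpace.basisFun (Fin 3) ℝ)) x,
    congrFun (InnerProductSpace.laplacian_eq_iteratedFDeriv_orthonormalBasis g (EuclideanSpace.basisFun (Fin 3) ℝ)) x]
  refine Finset.sum_congr rfl fun i _ => ?_
  rw [(h.iteratedFDeriv ℝ 2).eq_of_nhds]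

/-- ★ **(E1 on a ball) `CentreJet.centreVorticityJet_of_ball`.**  If `V ∈ C³(B(x₀, ρ))` is unthreaded about `x₀` on the ball —
`⟪x − x₀, curl V x⟫ = 0` for `‖x − x₀‖ < ρ` — then at the centre the vorticity vanishes, its gradient is skew and its Laplacian
vanishes.  (Radial cut-off + the global law E1 `centreVorticityJet`.) -/
theorem centreVorticityJet_of_ball (V : E3 → E3) (x₀ : E3) {ρ : ℝ} (hρ : 0 < ρ) (hV : ContDiffOn ℝ 3 V (Metric.ball x₀ ρ))
    (hun : ∀ x ∈ Metric.ball x₀ ρ, inner ℝ (x - x₀) (curl V x) = 0) :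
    curl V x₀ = 0 ∧ (∀ y : E3, inner ℝ y (fderiv ℝ (curl V) x₀ y) = 0) ∧ Laplacian.laplacian (curl V) x₀ = 0 := by
  -- the radial cut-off `χ(x) = ψ(‖x − x₀‖²)`
  let ψ : ContDiffBump (0 : ℝ) := ⟨(ρ / 2) ^ 2, (3 * ρ / 4) ^ 2, by positivity, by nlinarith⟩
  set χ : E3 → ℝ := fun x => ψ (‖x - x₀‖ ^ 2) with hχ
  have hχs : ContDiff ℝ 3 χ := (ψ.contDiff (n := 3)).comp ((contDiff_id.sub contDiff_const).norm_sq ℝ)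
  have hχd : ∀ x, HasFDerivAt χ (deriv (fun s : ℝ => ψ s) (‖x - x₀‖ ^ 2) • (2 • innerSL ℝ (x - x₀))) x := by
    intro x
    have h1 : HasFDerivAt (fun x : E3 => ‖x - x₀‖ ^ 2) (2 • innerSL ℝ (x - x₀)) x := by
      have := (hasStrictFDerivAt_norm_sq (x - x₀)).hasFDerivAt.comp x (hasFDerivAt_sub_const x₀)
      rw [ContinuousLinearMap.comp_id] at this
      exact this
    have hψd : DifferentiableAt ℝ (fun s : ℝ => ψ s) (‖x - x₀‖ ^ 2) :=
      ((ψ.contDiff (n := 1)).differentiable (by simp)).differentiableAt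
    have h2 : HasFDerivAt ((fun s : ℝ => ψ s) ∘ (fun x : E3 => ‖x - x₀‖ ^ 2))
        (deriv (fun s : ℝ => ψ s) (‖x - x₀‖ ^ 2) • (2 • innerSL ℝ (x - x₀))) x :=
      HasDerivAt.comp_hasFDerivAt x hψd.hasDerivAt h1
    exact h2
  -- `χ = 1` near `x₀`, `χ = 0` off the closed ball of radius `3ρ/4`
  have hχ1 : ∀ᶠ x in 𝓝 x₀, χ x = 1 := by
    filter_upwards [Metric.ball_mem_nhds x₀ (half_pos hρ)] with x hx
    refine ψ.one_of_mem_closedBall ?_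
    rw [Metric.mem_closedBall, dist_zero_right, Real.norm_eq_abs, abs_of_nonneg (sq_nonneg _),
      show ψ.rIn = (ρ / 2) ^ 2 from rfl]
    have h := (mem_ball_iff_norm.1 hx).le
    exact pow_le_pow_left₀ (norm_nonneg _) h 2
  have hχ0 : ∀ x, ρ ≤ ‖x - x₀‖ → ∀ᶠ z in 𝓝 x, χ z = 0 := by
    intro x hx
    have hopen : IsOpen {z : E3 | (3 * ρ / 4) ^ 2 < ‖z - x₀‖ ^ 2} :=
      isOpen_lt continuous_const ((continuous_id.sub continuous_const).norm.pow 2)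
    have hmem : x ∈ {z : E3 | (3 * ρ / 4) ^ 2 < ‖z - x₀‖ ^ 2} := by
      refine lt_of_lt_of_le ?_ (pow_le_pow_left₀ (by positivity) hx 2)
      nlinarith
    filter_upwards [hopen.mem_nhds hmem] with z hz
    refine ψ.zero_of_le_dist ?_
    rw [dist_zero_right, Real.norm_eq_abs, abs_of_nonneg (sq_nonneg _), show ψ.rOut = (3 * ρ / 4) ^ 2 from rfl]
    exact hz.le
  -- the cut-off field `W = χ V`
  set W : E3 → E3 := fun x => χ x • V x with hW
  have hWV : W =ᶠ[𝓝 x₀] V := by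
    filter_upwards [hχ1] with x hx
    simp [hW, hx]
  have hW3 : ContDiff ℝ 3 W := by
    rw [contDiff_iff_contDiffAt]
    intro x
    by_cases hx : x ∈ Metric.ball x₀ ρ
    · exact hχs.contDiffAt.smul (hV.contDiffAt (Metric.isOpen_ball.mem_nhds hx))
    · have hx' : ρ ≤ ‖x - x₀‖ := by
        rw [Metric.mem_ball, dist_eq_norm] at hx; exact not_lt.1 hx
      have hev : W =ᶠ[𝓝 x] fun _ => 0 := by
        filter_upwards [hχ0 x hx'] with z hz
        simp [hW, hz]
      exact contDiffAt_const.congr_of_eventuallyEq hev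
  -- `W` is unthreaded about `x₀` on all of `ℝ³`
  have hWun : ∀ x, inner ℝ (x - x₀) (curl W x) = 0 := by
    intro x
    by_cases hx : x ∈ Metric.ball x₀ ρ
    · have hVd : DifferentiableAt ℝ V x :=
        (hV.contDiffAt (Metric.isOpen_ball.mem_nhds hx)).differentiableAt (by norm_num)
      rw [hW, curl_smul (hχd x).differentiableAt hVd, (hχd x).fderiv, inner_add_right, inner_smul_right, hun x hx, mul_zero,
        zero_add]
      -- `curlCLM ((2c ⟪x − x₀, ·⟫) ⊗ V x) = 2c · ((x − x₀) × V x)`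
      have hsr : (deriv (fun s : ℝ => ψ s) (‖x - x₀‖ ^ 2) • (2 • innerSL ℝ (x - x₀))).smulRight (V x) =
          (2 * deriv (fun s : ℝ => ψ s) (‖x - x₀‖ ^ 2)) • (innerSL ℝ (x - x₀)).smulRight (V x) := by
        ext1 w
        simp only [ContinuousLinearMap.smulRight_apply, FunLike.coe_smul, Pi.smul_apply, innerSL_apply_apply,
          smul_smul, smul_eq_mul]
        ring_nf
      rw [hsr, map_smul, curlCLM_smulRight_innerSL, inner_smul_right, real_inner_comm, Tao2016.inner_cross_self_left, mul_zero]
    · have hx' : ρ ≤ ‖x - x₀‖ := by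
        rw [Metric.mem_ball, dist_eq_norm] at hx; exact not_lt.1 hx
      have hev : W =ᶠ[𝓝 x] fun _ => 0 := by
        filter_upwards [hχ0 x hx'] with z hz
        simp [hW, hz]
      rw [curl_eq_curlCLM, hev.fderiv_eq, ← curl_eq_curlCLM, curl_fun_zero, inner_zero_right]
  -- the global law E1 for `W`, transported to `V` through the germ at `x₀`
  obtain ⟨h0, h1, h2⟩ := centreVorticityJet W x₀ hW3 hWun
  have hcurl : curl W =ᶠ[𝓝 x₀] curl V := by
    obtain ⟨N, hN, hNo, hx₀N⟩ := mem_nhds_iff.1 hWV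
    filter_upwards [hNo.mem_nhds hx₀N] with z hz
    have hzw : W =ᶠ[𝓝 z] V := Filter.eventuallyEq_of_mem (hNo.mem_nhds hz) fun w hw => hN hw
    rw [curl_eq_curlCLM, curl_eq_curlCLM, hzw.fderiv_eq]
  refine ⟨?_, fun y => ?_, ?_⟩
  · rw [← hcurl.eq_of_nhds]; exact h0
  · rw [← hcurl.fderiv_eq]; exact h1 y
  · rw [← laplacian_congr_of_eventuallyEq hcurl]; exact h2

end RadialCutoff

end Summit.NavierStokesRegularity.NavierStokesRegularity.Theorems.PoloidalLiouville.CentreJet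

end
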